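import Summits.AnomalousDissipation.AnomalousDissipation.Theorems.SolenoidalFractalHomogenisationLagrangianStepW7Assembly
import Summits.AnomalousDissipation.AnomalousDissipation.Theorems.SolenoidalFractalHomogenisationLagrangianStepW7CellSlotR
import Summits.AnomalousDissipation.AnomalousDissipation.Theorems.SolenoidalFractalHomogenisationLagrangianStepW7ChainGeometryR
import Summits.AnomalousDissipation.AnomalousDissipation.Theorems.SolenoidalFractalHomogenisationLagrangianStepCellChainSetupFrame
import Summits.AnomalousDissipation.AnomalousDissipation.Theorems.SolenoidalFractalHomogenisationLagrangianStepCellChainBareDecayFrame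
import Summits.AnomalousDissipation.AnomalousDissipation.Theorems.SolenoidalFractalHomogenisationLagrangianStepCellChainRegimeToolsFrame
import HarnessLib

/-!
# K1L_D (stmt-AnomalousDissipation-27980), (ℓ3) (D-TH)₀ — W7 HIGH-LABEL DECAY ENGINE AT A FROZEN FRAME `G₀`: the per-class exponential decay
# `ClassDecayWθ G₀` of the cubature cell problem with `ν`-UNIFORM, FRAME-UNIFORM rate, for every frame `|G₀ − 1| ≤ θW`
# (helper; `--supports stmt-AnomalousDissipation-27980 --as helper`)

Port plan B10 (`HOME/ad-sawtooth-k1loc-p1/g16/W7thg-portplan-k1locp1g16.md`; prover ad-sawtooth-k1loc-p1 g16): the frozen-frame twin of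
`W7Cell.classDecayW_chain` / `classDecayW_cubature_all` (`…W7Assembly`).  THE FRAME SLACK: with `γ` the coupling constant of
`HighLabelDecay.coupledUnshielded_quant`, `θW := min (1/6) √(γ/4392)`; for `|G₀ − 1| ≤ θW` entrywise the twisted window numbers move inside
`(1 − 3θW)²·lo ≤ · ≤ (1 + 3θW)²·(hi, β)` (`chain_window_numbersR`, `le_freqNormSq_twist`, `freqNormSq_twist_le`), the twisted drain coefficient stays in
`[γ/304, 2]` (`q_chain_boundsR`), and the flat uniform floor `W7Engine.floor_uniform` is applied BY NAME at `lo ↦ (1−3θW)²lo`, `(hi, β) ↦ (1+3θW)²(hi, β)`,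
`γ ↦ 15γ/304`; one covering slot per period contracts the energy by `e^{−κ₀}` (`W7Cell.cell_slot_contractionR`), `profile_capped_on` gives the profile.
* `classDecayWθ_chain` — near classes (`∃ z, ‖ℓ + nz‖ < n/2`): `∃ θW > 0, θW ≤ 1/6 ∧ ∃ cK > 0, ∀ G₀, |G₀ − 1| ≤ θW → ClassDecayWθ G₀ cubatureWord M hM lo hi Λ β 1 Kb e cK near`;
* `classDecayWθ_cubature_all` — all classes, spliced with the frozen bare engine `classDecayWθ_bare` (far classes, frame non-degeneracy `c₀ = (1−3θW)²`)
  by `classDecayWθ_split_kt`.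
No definitions, no sorry.  NOT a proof of `stub_W7thg` (that is B13, two files up), of K1L_D or of AD; rung F-D1.A0.
[cite: BedrossianCotiZelati2017, Thm 1.1 / §2 (hypocoercivity, ν-uniform rate)] [problem: turb]
-/

set_option linter.dupNamespace false

noncomputable section

namespace Summit.AnomalousDissipation.AnomalousDissipation.Theorems.SolenoidalFractalHomogenisation.LagrangianStep.W7Cell

open Set Real MeasureTheory intervalIntegral Filter Topology Function Complex UnitAddTorus
open scoped InnerProductSpace ComplexConjugate
open Literature.Analysis Literature.Analysis.FunctionSpaces Literature.Analysis.FunctionSpaces.Torus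
open Literature.Analysis.FluidPDE Literature.Analysis.FluidPDE.Torus Literature.Analysis.FluidPDE.LatticeShear
open Summit.AnomalousDissipation.AnomalousDissipation.Theorems
open Summit.AnomalousDissipation.AnomalousDissipation.Theorems.SolenoidalFractalHomogenisation.RealisedQuasiStaticCellLaw
open Summit.AnomalousDissipation.AnomalousDissipation.Theorems.SolenoidalFractalHomogenisation.PermissibleCarrier
open Summit.AnomalousDissipation.AnomalousDissipation.Theorems.SolenoidalFractalHomogenisation.LagrangianStep
open Summit.AnomalousDissipation.AnomalousDissipation.Theorems.SolenoidalFractalHomogenisation.LagrangianStep.CellChain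
open Summit.AnomalousDissipation.AnomalousDissipation.Theorems.SolenoidalFractalHomogenisation.LagrangianStep.W7Engine
open Summit.AnomalousDissipation.AnomalousDissipation.Theorems.SolenoidalFractalHomogenisation.LagrangianStep.W7Slot
open Summit.AnomalousDissipation.AnomalousDissipation.Theorems.SolenoidalFractalHomogenisation.LagrangianStep.ThreeMode

/-! ## §1 The frame slack `θW` -/

/-- The frame slack `θW = min (1/6) √(γ/4392)`: `0 < θW ≤ 1/6 ≤ 1/3` and `4392·θW² ≤ γ`. -/
theorem thetaW_props {γ : ℝ} (hγ : 0 < γ) :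
    0 < min (1 / 6 : ℝ) (Real.sqrt (γ / 4392)) ∧ min (1 / 6 : ℝ) (Real.sqrt (γ / 4392)) ≤ 1 / 6 ∧
      min (1 / 6 : ℝ) (Real.sqrt (γ / 4392)) ≤ 1 / 3 ∧ 4392 * (min (1 / 6 : ℝ) (Real.sqrt (γ / 4392))) ^ 2 ≤ γ := by
  have hs : 0 < Real.sqrt (γ / 4392) := Real.sqrt_pos.2 (by positivity)
  refine ⟨lt_min (by norm_num) hs, min_le_left _ _, (min_le_left _ _).trans (by norm_num), ?_⟩
  have h1 : (min (1 / 6 : ℝ) (Real.sqrt (γ / 4392))) ^ 2 ≤ Real.sqrt (γ / 4392) ^ 2 :=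
    pow_le_pow_left₀ (le_min (by norm_num) hs.le) (min_le_right _ _) 2
  rw [Real.sq_sqrt (by positivity)] at h1
  linarith

/-! ## §2 The near-class engine at a frozen frame -/

set_option maxHeartbeats 1600000 in
/-- **THE NEAR-CLASS ENGINE AT A FROZEN FRAME** (W7, regime `k̃ < 1/2`, every frame `|G₀ − 1| ≤ θW`): `ClassDecayWθ G₀ cubatureWord M hM lo hi Λ β 1 Kb
(exp 1) cK (near classes)` with the `ν`- and frame-uniform rate `cK = min κ₀ 1/(7440 M)`, `κ₀` the flat uniform slot floor at the slackened window
numbers.  One covering slot per period contracts the energy by `e^{−κ₀}` (`cell_slot_contractionR`); `profile_capped_on` turns this into the exponential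
profile. [cite: BedrossianCotiZelati2017, Thm 1.1 / §2 (hypocoercivity, ν-uniform rate)] -/
theorem classDecayWθ_chain (M : ℝ) (hM : 0 < M) {lo hi Λ β Kb : ℝ} (hlo : 0 < lo) (hlo1 : lo ≤ 1) (hhi : 1 ≤ hi)
    (hΛ : 1 < Λ) (hβ : 0 ≤ β) (hKb : 1 ≤ Kb) :
    ∃ θW > (0:ℝ), θW ≤ 1 / 6 ∧ ∃ cK > (0:ℝ), ∀ G₀ : Matrix (Fin 3) (Fin 3) ℝ, (∀ i j, |G₀ i j - (1 : Matrix (Fin 3) (Fin 3) ℝ) i j| ≤ θW) →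
      ClassDecayWθ G₀ cubatureWord M hM lo hi Λ β 1 Kb (Real.exp 1) cK
        (fun n _ ℓ => ∃ z : Fin 3 → ℤ, ‖Torus.latticeVec (ℓ + (n : ℤ) • z)‖ < 1 / 2 * n) := by
  obtain ⟨γ, hγ, hcu⟩ := HighLabelDecay.coupledUnshielded_quant
  obtain ⟨θW, hθWdef⟩ : ∃ x : ℝ, x = min (1 / 6 : ℝ) (Real.sqrt (γ / 4392)) := ⟨_, rfl⟩
  obtain ⟨hθW0, hθW6, hθW3, hθWγ⟩ : 0 < θW ∧ θW ≤ 1 / 6 ∧ θW ≤ 1 / 3 ∧ 4392 * θW ^ 2 ≤ γ := by rw [hθWdef]; exact thetaW_props hγ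
  have hΛ1 : 1 ≤ Λ := hΛ.le
  have hΛ0 : 0 < Λ := by linarith
  have hhi0 : 0 ≤ hi := by linarith
  have hhb : 0 < hi * Λ + β / 2 := by nlinarith
  have hKb0 : 0 < Kb := by linarith
  have hc₀pos : 0 < (1 - 3 * θW) ^ 2 := by nlinarith
  have hp3 : 0 < (1 + 3 * θW) ^ 2 := by positivity
  have hlo'0 : 0 < ((1 - 3 * θW) ^ 2 * lo) := mul_pos hc₀pos hlo
  have hhb' : 0 < ((1 + 3 * θW) ^ 2 * hi) * Λ + ((1 + 3 * θW) ^ 2 * β) / 2 := by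
    have : ((1 + 3 * θW) ^ 2 * hi) * Λ + ((1 + 3 * θW) ^ 2 * β) / 2 = (1 + 3 * θW) ^ 2 * (hi * Λ + β / 2) := by ring
    rw [this]; positivity
  have hγ' : 0 < (15 * γ / 304) := by positivity
  obtain ⟨κ₀, hκ₀pos, hκ₀def⟩ : ∃ κ₀ : ℝ, 0 < κ₀ ∧ κ₀ = (min (min (Real.pi ^ 2 * ((1 - 3 * θW) ^ 2 * lo) * ((15 * γ / 304) / 15) * M * 40 / (216 * Λ))
          (((1 - 3 * θW) ^ 2 * lo) * ((15 * γ / 304) / (216 * Kb ^ 2)) * ((15 * γ / 304) / 15) * M * 40 / (108 * 625 * Real.pi ^ 2 * Λ * (((1 + 3 * θW) ^ 2 * hi) * Λ + ((1 + 3 * θW) ^ 2 * β) / 2) ^ 2)))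
        (min (((1 - 3 * θW) ^ 2 * lo) * ((15 * γ / 304) / 216) * ((15 * γ / 304) / 15) * M * 40 / (432 * Real.pi ^ 2 * Λ * (((1 + 3 * θW) ^ 2 * hi) * Λ + ((1 + 3 * θW) ^ 2 * β) / 2) ^ 2))
          (7 * Real.pi ^ 2 * ((1 - 3 * θW) ^ 2 * lo) * ((15 * γ / 304) / 15) ^ 2 * M ^ 3 * 40 ^ 3 * ((15 * γ / 304) / (216 * Kb ^ 2)) / (46656 * Λ)))) :=
    ⟨_, kappa0_pos hlo'0 hΛ1 hhb' hM hKb0 hγ', rfl⟩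
  refine ⟨θW, hθW0, hθW6, min κ₀ 1 / (7440 * M), by positivity, ?_⟩
  intro G₀ hG ν hν n hn 𝔸 hodd hwin L hL hKL ℓ hdist hnear F hF1 hF2 hF3 hsupp T hT u hu
  have hν0 : 0 < ν := hν.1
  have hν1 : ν ≤ 1 := hν.2.le
  have hn0 : (0:ℝ) < n := by exact_mod_cast hn
  -- frame non-degeneracy `c₀ = (1 − 3θW)²`
  have hGc : ∀ k' : Fin 3 → ℤ, (1 - 3 * θW) ^ 2 * freqNormSq k' ≤ ∑ a, Torus.twistFreq G₀ k' a ^ 2 :=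
    fun k' => le_freqNormSq_twist hθW0.le hθW3 hG k'
  obtain ⟨hN, ⟨hF2', hFi, hFdiv⟩, ⟨E, Q, hE0, hEform, hEcont, hEanti, hEac, hEae, hQint, hQnn, hEd, hQS, hcoer2⟩, hclass, hrep⟩ :=
    classDecayWθ_setup cubatureWord M hM hlo hhi0 hΛ1 hν0 hn hwin hc₀pos hGc ℓ hF1 hF3 hsupp hT hu
  have hcoer : ∀ᵐ t ∂(volume.restrict (Ioo 0 T)), ∀ k' : Fin 3 → ℤ,
      ((1 / (n:ℝ) ^ 2) * (ν * (lo / Λ))) * (1 - 3 * θW) ^ 2 * (freqNormSq k' * ‖mFourierCoeff (EuclideanSpace.complexify ∘ u t) k'‖ ^ 2) ≤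
        (⟪mFourierCoeff (EuclideanSpace.complexify ∘ u t) k', Torus.symbT (Torus.Visc4.conj G₀ ((1 / (n:ℝ) ^ 2) • 𝔸)) k' (mFourierCoeff (EuclideanSpace.complexify ∘ u t) k')⟫_ℂ).re :=
    hcoer2.mono fun t ht k' => (ht k').2
  set W₁ : LatticeWord 26 := (cubatureWord.stretch M hM).stretch (1 / ν) (one_div_pos.mpr hν0) with hW₁
  have hu' : Torus.IsWeakTensorPassiveVectorDistortedOn 0 T ((1 / (n:ℝ) ^ 2) • 𝔸) (W₁.cell n) (fun _ _ => G₀) F u := by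
    rw [hW₁, ← cellField_eq_cell]; exact hu
  have hodd' : Torus.OddSmall ((1 / (n:ℝ) ^ 2) • 𝔸) ((1 / (n:ℝ) ^ 2) * (ν * β)) := hodd.smul _
  have hlon0 : 0 < ((1 / (n:ℝ) ^ 2) * (ν * (lo / Λ))) := by positivity
  have hhin0 : 0 ≤ (1 / (n:ℝ) ^ 2) * (ν * (hi * Λ)) := by positivity
  have hben0 : 0 ≤ (1 / (n:ℝ) ^ 2) * (ν * β) := by positivity
  -- the energy is nonnegative on `[0,T]`
  have hEnn : ∀ t ∈ Icc 0 T, 0 ≤ E t :=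
    le_on_Icc_of_ae_le (f := fun _ => (0:ℝ)) (g := E) hT continuousOn_const hEcont
      (hEae.mono fun t ht => by rw [ht]; positivity)
  -- the near representative `K₀` of the class
  obtain ⟨z₀, hz₀⟩ := hnear
  obtain ⟨K0, hK0def⟩ : ∃ K0 : Fin 3 → ℤ, K0 = ℓ + (n : ℤ) • z₀ := ⟨_, rfl⟩
  have hK0norm : ‖Torus.latticeVec K0‖ < 1 / 2 * n := by rw [hK0def]; exact hz₀
  have h2 : 2 * ‖Torus.latticeVec K0‖ < n := by linarith
  have hK0L : L ≤ ‖Torus.latticeVec K0‖ := by rw [hK0def]; exact hdist z₀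
  have hK0n : 0 < ‖Torus.latticeVec K0‖ := lt_of_lt_of_le hL hK0L
  have hK0 : K0 ≠ 0 := by
    intro h; rw [h, latticeVec_zero, norm_zero] at hK0n; exact lt_irrefl _ hK0n
  have hdistK : ∀ z : Fin 3 → ℤ, L ≤ ‖Torus.latticeVec (K0 + (n : ℤ) • z)‖ := fun z => by
    have e : K0 + (n : ℤ) • z = ℓ + (n : ℤ) • (z₀ + z) := by rw [hK0def, smul_add]; abel
    rw [e]; exact hdist _
  have hkt : ν / Kb ≤ ‖Torus.latticeVec K0‖ / n := by
    rw [div_le_div_iff₀ hKb0 hn0]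
    calc ν * (n:ℝ) = (n:ℝ) * ν := mul_comm _ _
      _ ≤ Kb * L := hKL
      _ ≤ Kb * ‖Torus.latticeVec K0‖ := mul_le_mul_of_nonneg_left hK0L hKb0.le
      _ = ‖Torus.latticeVec K0‖ * Kb := mul_comm _ _
  have hkt0 : 0 < ‖Torus.latticeVec K0‖ / n := by positivity
  -- the covering slot `j`
  have hunit : ‖(1 / ‖Torus.latticeVec K0‖) • Torus.latticeVec K0‖ = 1 := by
    rw [norm_smul, norm_div, norm_one, Real.norm_eq_abs, abs_of_pos hK0n, one_div, inv_mul_cancel₀ hK0n.ne']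
  obtain ⟨j, hj⟩ := hcu _ hunit
  obtain ⟨hnv1, hnv6, hτ40, hm3i, hv2i⟩ := slots_ranges j
  have hphm : (W₁.phase j).m = (slots j).m := rfl
  have hphτ : (W₁.phase j).τ = 1 / ν * (M * ((slots j).τ : ℝ)) := rfl
  have hramp : W₁.ramp = 1 / 2 := rfl
  have hP : W₁.period = 1 / ν * (M * 3720) := period_stretch_cubature M hM ν _
  have hP0 : 0 < W₁.period := by rw [hP]; positivity
  have hmne : (W₁.phase j).m ≠ 0 := (W₁.phase j).m_ne
  have hm3 : freqNormSq (W₁.phase j).m ≤ 3 := by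
    rw [hphm, freqNormSq, Fin.sum_univ_three]; exact_mod_cast hm3i
  have hm2r : ((slots j).m 0 : ℝ) ^ 2 + ((slots j).m 1 : ℝ) ^ 2 + ((slots j).m 2 : ℝ) ^ 2 ≤ 3 := by exact_mod_cast hm3i
  have hv2r : ((slots j).v 0 : ℝ) ^ 2 + ((slots j).v 1 : ℝ) ^ 2 + ((slots j).v 2 : ℝ) ^ 2 ≤ 6 := by
    have e : ((slots j).v 0 : ℝ) ^ 2 + ((slots j).v 1 : ℝ) ^ 2 + ((slots j).v 2 : ℝ) ^ 2 = ((slots j).n : ℝ) := by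
      exact_mod_cast hv2i
    rw [e]; exact_mod_cast hnv6
  have hτ40r : (40:ℝ) ≤ ((slots j).τ : ℝ) := by exact_mod_cast hτ40
  obtain ⟨hcovV, hcovM⟩ := cuPoly_unpack hK0 j hv2r hm2r hj
  have hcovM' : γ / 6 * ‖Torus.latticeVec K0‖ ^ 2 ≤ (∑ i, (K0 i : ℝ) * (W₁.phase j).m i) ^ 2 := hcovM
  -- the cell frequency and the ten-vector block
  have hKs : (fun i => (W₁.phase j).m i * (n : ℤ)) ≠ 0 := cellFreq_ne_zero (W₁.phase j) hn
  have hKs2 : 2 * ‖Torus.latticeVec K0‖ < ‖Torus.latticeVec (fun i => (W₁.phase j).m i * (n : ℤ))‖ := by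
    rw [norm_cellFreq]
    have h1 := Torus.one_le_norm_latticeVec hmne
    calc 2 * ‖Torus.latticeVec K0‖ < (n:ℝ) := h2
      _ = (n:ℝ) * 1 := (mul_one _).symm
      _ ≤ (n:ℝ) * ‖Torus.latticeVec (W₁.phase j).m‖ := mul_le_mul_of_nonneg_left h1 hn0.le
  have hdisj : ∀ j₁ ∈ ({-2, -1, 0, 1, 2} : Finset ℤ), ∀ j₂ ∈ ({-2, -1, 0, 1, 2} : Finset ℤ),
      K0 + j₁ • (fun i => (W₁.phase j).m i * (n : ℤ)) ≠ -(K0 + j₂ • (fun i => (W₁.phase j).m i * (n : ℤ))) :=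
    fun j₁ _ j₂ _ => windows_disjoint_of_two_norm_lt hK0 hKs2 j₁ j₂
  -- the slackened window numbers
  obtain ⟨dmin, hdmin⟩ : ∃ x : ℝ, x = Real.pi ^ 2 * ν * ((1 - 3 * θW) ^ 2 * lo) / Λ := ⟨_, rfl⟩
  obtain ⟨Dmax, hDmax⟩ : ∃ x : ℝ, x = 25 * Real.pi ^ 2 * ν * (((1 + 3 * θW) ^ 2 * hi) * Λ + ((1 + 3 * θW) ^ 2 * β) / 2) := ⟨_, rfl⟩
  have hdmin0 : 0 < dmin := by rw [hdmin]; positivity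
  have hDmax0 : 0 < Dmax := by rw [hDmax]; positivity
  obtain ⟨hwlo, hwhi, hdD⟩ := chain_window_numbersR (K0 := K0) (m := (W₁.phase j).m) (ν := ν) (lo := lo) (hi := hi) (Λ := Λ)
    (β := β) hn hmne hm3 hK0 h2 hν0 hlo hlo1 hhi hΛ1 hβ hθW0.le hθW3 hG
  have hdminE : dmin = Real.pi ^ 2 * ν * ((1 - 3 * θW) ^ 2 * lo) / Λ := by rw [hdmin]
  have hDmaxE : Dmax = 25 * Real.pi ^ 2 * ν * ((1 + 3 * θW) ^ 2 * (hi * Λ + β / 2)) := by rw [hDmax]; ring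
  have hdD' : dmin ≤ Dmax := by rw [hdminE, hDmaxE]; exact hdD
  obtain ⟨d0, hd0⟩ : ∃ x : ℝ, x = 4 * Real.pi ^ 2 * ν * ((1 - 3 * θW) ^ 2 * lo) * (‖Torus.latticeVec K0‖ / n) ^ 2 / Λ := ⟨_, rfl⟩
  obtain ⟨D0, hD0⟩ : ∃ x : ℝ, x = 4 * Real.pi ^ 2 * ν * (((1 + 3 * θW) ^ 2 * hi) * Λ + ((1 + 3 * θW) ^ 2 * β) / 2) * (‖Torus.latticeVec K0‖ / n) ^ 2 := ⟨_, rfl⟩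
  have hd0pos : 0 < d0 := by rw [hd0]; positivity
  have hD0pos : 0 < D0 := by rw [hD0]; positivity
  have hK0tw : Torus.twistFreq G₀ (K0 + (0:ℤ) • (fun i => (W₁.phase j).m i * (n : ℤ))) = Torus.twistFreq G₀ K0 := by rw [zero_smul, add_zero]
  have hK0sq : freqNormSq K0 = ‖Torus.latticeVec K0‖ ^ 2 := (Literature.Analysis.FunctionSpaces.Torus.norm_latticeVec_sq K0).symm
  have hd0le : d0 ≤ 4 * Real.pi ^ 2 * ((1 / (n:ℝ) ^ 2) * (ν * (lo / Λ))) * (∑ b, Torus.twistFreq G₀ (K0 + (0:ℤ) • (fun i => (W₁.phase j).m i * (n : ℤ))) b ^ 2) := by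
    rw [hK0tw, hd0]
    have h1 := hGc K0
    rw [hK0sq] at h1
    have e : 4 * Real.pi ^ 2 * ν * ((1 - 3 * θW) ^ 2 * lo) * (‖Torus.latticeVec K0‖ / n) ^ 2 / Λ
        = 4 * Real.pi ^ 2 * ((1 / (n:ℝ) ^ 2) * (ν * (lo / Λ))) * ((1 - 3 * θW) ^ 2 * ‖Torus.latticeVec K0‖ ^ 2) := by field_simp
    rw [e]
    exact mul_le_mul_of_nonneg_left h1 (by positivity)
  have hD0ge : 4 * Real.pi ^ 2 * ((1 / (n:ℝ) ^ 2) * (ν * (hi * Λ)) + (1 / (n:ℝ) ^ 2) * (ν * β) / 2) * (∑ b, Torus.twistFreq G₀ (K0 + (0:ℤ) • (fun i => (W₁.phase j).m i * (n : ℤ))) b ^ 2) ≤ D0 := by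
    rw [hK0tw, hD0]
    have h1 := freqNormSq_twist_le hθW0.le hG K0
    rw [hK0sq] at h1
    have e : 4 * Real.pi ^ 2 * ν * (((1 + 3 * θW) ^ 2 * hi) * Λ + ((1 + 3 * θW) ^ 2 * β) / 2) * (‖Torus.latticeVec K0‖ / n) ^ 2
        = 4 * Real.pi ^ 2 * ((1 / (n:ℝ) ^ 2) * (ν * (hi * Λ)) + (1 / (n:ℝ) ^ 2) * (ν * β) / 2) * ((1 + 3 * θW) ^ 2 * ‖Torus.latticeVec K0‖ ^ 2) := by
      field_simp
    rw [e]
    exact mul_le_mul_of_nonneg_left h1 (by positivity)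
  have hτ'eq : (W₁.phase j).τ = M * ((slots j).τ : ℝ) / ν := by rw [hphτ]; field_simp
  have hτ'0 : 0 < (W₁.phase j).τ := (W₁.phase j).τ_pos
  -- the link constant and the twisted drain coefficient
  obtain ⟨c, hc⟩ : ∃ x : ℝ, x = |∑ a, (W₁.phase j).e a * (K0 a : ℝ)| * (1 / (n : ℝ)) / (2 * ‖Torus.latticeVec (W₁.phase j).m‖) :=
    ⟨_, rfl⟩
  obtain ⟨hc0, hc2⟩ := c_chain_bounds (K0 := K0) (m := (slots j).m) (v := (slots j).v) (n := n) (nv := (slots j).n) (γ := γ)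
    (c := c) hn hmne hm3 hnv1 hnv6 hγ hK0 hcovV (by rw [hc]; rfl)
  have hc2' : (‖Torus.latticeVec K0‖ / n) ^ 2 * (15 * γ / 304) / 216 ≤ c ^ 2 := by
    refine le_trans ?_ hc2
    have : (15 * γ / 304) ≤ γ := by linarith
    have hk2 : 0 ≤ (‖Torus.latticeVec K0‖ / n) ^ 2 := sq_nonneg _
    nlinarith
  obtain ⟨hq304, hq2⟩ := q_chain_boundsR (K0 := K0) (m := (W₁.phase j).m) (n := n) hK0 h2 hm3 hγ.le hθW0.le hθW6 hθWγ hG hcovM'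
  have hq0 : 0 < (2 - ((∑ a, Torus.twistFreq G₀ (fun i => (W₁.phase j).m i * (n : ℤ)) a ^ 2)
          - (∑ i, Torus.twistFreq G₀ K0 i * Torus.twistFreq G₀ (fun i => (W₁.phase j).m i * (n : ℤ)) i) ^ 2 / ∑ a, Torus.twistFreq G₀ K0 a ^ 2)
        * (1 / (∑ a, (Torus.twistFreq G₀ K0 + Torus.twistFreq G₀ (fun i => (W₁.phase j).m i * (n : ℤ))) a ^ 2)
          + 1 / (∑ a, (Torus.twistFreq G₀ K0 - Torus.twistFreq G₀ (fun i => (W₁.phase j).m i * (n : ℤ))) a ^ 2))) := lt_of_lt_of_le (by positivity) hq304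
  have hq15 : (15 * γ / 304) / 15 ≤ (2 - ((∑ a, Torus.twistFreq G₀ (fun i => (W₁.phase j).m i * (n : ℤ)) a ^ 2)
          - (∑ i, Torus.twistFreq G₀ K0 i * Torus.twistFreq G₀ (fun i => (W₁.phase j).m i * (n : ℤ)) i) ^ 2 / ∑ a, Torus.twistFreq G₀ K0 a ^ 2)
        * (1 / (∑ a, (Torus.twistFreq G₀ K0 + Torus.twistFreq G₀ (fun i => (W₁.phase j).m i * (n : ℤ))) a ^ 2)
          + 1 / (∑ a, (Torus.twistFreq G₀ K0 - Torus.twistFreq G₀ (fun i => (W₁.phase j).m i * (n : ℤ))) a ^ 2))) := by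
    have : (15 * γ / 304) / 15 = γ / 304 := by ring
    rw [this]; exact hq304
  have hqw : ∀ z : EuclideanSpace ℂ (Fin 3), Torus.rdot (Torus.twistFreq G₀ (K0 + (0:ℤ) • (fun i => (W₁.phase j).m i * (n : ℤ)))) z = 0 →
      (2 - ((∑ a, Torus.twistFreq G₀ (fun i => (W₁.phase j).m i * (n : ℤ)) a ^ 2)
          - (∑ i, Torus.twistFreq G₀ K0 i * Torus.twistFreq G₀ (fun i => (W₁.phase j).m i * (n : ℤ)) i) ^ 2 / ∑ a, Torus.twistFreq G₀ K0 a ^ 2)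
        * (1 / (∑ a, (Torus.twistFreq G₀ K0 + Torus.twistFreq G₀ (fun i => (W₁.phase j).m i * (n : ℤ))) a ^ 2)
          + 1 / (∑ a, (Torus.twistFreq G₀ K0 - Torus.twistFreq G₀ (fun i => (W₁.phase j).m i * (n : ℤ))) a ^ 2))) * ‖z‖ ^ 2 ≤ ‖Torus.transversalProjR (Torus.twistFreq G₀ (K0 + (1:ℤ) • (fun i => (W₁.phase j).m i * (n : ℤ)))) z‖ ^ 2 + ‖Torus.transversalProjR (Torus.twistFreq G₀ (K0 + (-1:ℤ) • (fun i => (W₁.phase j).m i * (n : ℤ)))) z‖ ^ 2 :=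
    fun z hz => hqw_chainR G₀ K0 (fun i => (W₁.phase j).m i * (n : ℤ)) z hz
  -- the hypocoercivity parameter and the floor
  obtain ⟨ε, hε⟩ : ∃ x : ℝ, x = min (min (dmin / (8 * c ^ 2)) (dmin / (4 * Dmax ^ 2)))
      (min (d0 / (4 * D0 ^ 2)) (7 * (2 - ((∑ a, Torus.twistFreq G₀ (fun i => (W₁.phase j).m i * (n : ℤ)) a ^ 2)
          - (∑ i, Torus.twistFreq G₀ K0 i * Torus.twistFreq G₀ (fun i => (W₁.phase j).m i * (n : ℤ)) i) ^ 2 / ∑ a, Torus.twistFreq G₀ K0 a ^ 2)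
        * (1 / (∑ a, (Torus.twistFreq G₀ K0 + Torus.twistFreq G₀ (fun i => (W₁.phase j).m i * (n : ℤ))) a ^ 2)
          + 1 / (∑ a, (Torus.twistFreq G₀ K0 - Torus.twistFreq G₀ (fun i => (W₁.phase j).m i * (n : ℤ))) a ^ 2))) * dmin * (W₁.phase j).τ ^ 2 / 1728)) := ⟨_, rfl⟩
  obtain ⟨hε0, c1, c2, c3, c4, c5⟩ := floor_caps hdmin0 hDmax0 hd0pos hD0pos hτ'0 hq0 hc0 hε
  have hfloor := floor_uniform (lo := ((1 - 3 * θW) ^ 2 * lo)) (hi := ((1 + 3 * θW) ^ 2 * hi)) (β := ((1 + 3 * θW) ^ 2 * β)) (γ := (15 * γ / 304)) hν0 hν1 hlo'0 hΛ1 hhb' hM hKb0 hγ' hkt hkt0 hτ40r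
    hq15 hc0 hc2' hdmin hDmax hd0 hD0 hτ'eq hε
  rw [← hκ₀def] at hfloor
  -- the gap off the block (coercivity constant `loc = lo_n·(1 − 3θW)²`)
  have hgap : ∀ᵐ t ∂(volume.restrict (Ioo 0 T)), ∀ k : Fin 3 → ℤ,
      (∀ j' ∈ ({-2, -1, 0, 1, 2} : Finset ℤ), k ≠ K0 + j' • (fun i => (W₁.phase j).m i * (n : ℤ)) ∧ k ≠ -(K0 + j' • (fun i => (W₁.phase j).m i * (n : ℤ)))) →
      mFourierCoeff (EuclideanSpace.complexify ∘ u t) k ≠ 0 → dmin ≤ 8 * Real.pi ^ 2 * (((1 / (n:ℝ) ^ 2) * (ν * (lo / Λ))) * (1 - 3 * θW) ^ 2) * freqNormSq k := by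
    have e : 8 * Real.pi ^ 2 * (((1 / (n:ℝ) ^ 2) * (ν * (lo / Λ))) * (1 - 3 * θW) ^ 2) = 8 * Real.pi ^ 2 * ((1 / (n:ℝ) ^ 2) * (ν * (((1 - 3 * θW) ^ 2 * lo) / Λ))) := by ring
    rw [hdmin, e]
    exact ae_gap_chain (m := (W₁.phase j).m) hn hν0 hlo'0 hΛ1 hK0def h2 hclass
  -- ONE PERIOD: the covering slot contracts by `e^{−κ₀}`, the energy is antitone elsewhere
  have hs0 := start_nonneg W₁ j
  have hsP := start_add_tau_le_period W₁ j
  have hper : ∀ p : ℕ, (0:ℝ) + (p + 1) * W₁.period ≤ T →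
      E (0 + (p + 1) * W₁.period) ≤ Real.exp (-κ₀) * E (0 + p * W₁.period) := by
    intro p hp
    have hpP : 0 ≤ (p:ℝ) * W₁.period := by positivity
    have ht₀ : 0 ≤ ((p:ℤ):ℝ) * W₁.period + W₁.start j := by push_cast; positivity
    have ht₁ : ((p:ℤ):ℝ) * W₁.period + W₁.start j + (W₁.phase j).τ ≤ T := by push_cast; linarith
    have hstep := cell_slot_contractionR W₁ n hT hN hlon0 hhin0 hodd' hben0 hFi hu' hramp hEcont hEac hEae hEd hQS hcoer j (p:ℤ)
      ht₀ ht₁ K0 hKs hdisj hdmin0 hdmin0.le hd0pos.le hD0pos.le hε0 hq0.le hq2 hc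
      (by rw [hdminE]; exact hwlo 1 one_ne_zero) (by rw [hdminE]; exact hwlo (-1) (by norm_num))
      (by rw [hdminE]; exact hwlo 2 (by norm_num)) (by rw [hdminE]; exact hwlo (-2) (by norm_num))
      (by rw [hDmaxE]; exact hwhi 1 (Or.inl rfl)) (by rw [hDmaxE]; exact hwhi (-1) (Or.inr rfl)) hdD'
      c1 c2 c3 hd0le hD0ge c4 c5 hqw hgap
    have hw0 : (0:ℝ) + p * W₁.period ≤ ((p:ℤ):ℝ) * W₁.period + W₁.start j := by push_cast; linarith
    have hw1 : ((p:ℤ):ℝ) * W₁.period + W₁.start j + (W₁.phase j).τ ≤ 0 + (p + 1) * W₁.period := by push_cast; linarith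
    have hI0 : (0:ℝ) + p * W₁.period ∈ Icc 0 T := ⟨by linarith, by linarith⟩
    have hIw0 : ((p:ℤ):ℝ) * W₁.period + W₁.start j ∈ Icc 0 T := ⟨ht₀, by linarith⟩
    have hIw1 : ((p:ℤ):ℝ) * W₁.period + W₁.start j + (W₁.phase j).τ ∈ Icc 0 T := ⟨by linarith, ht₁⟩
    have hI1 : (0:ℝ) + (p + 1) * W₁.period ∈ Icc 0 T := ⟨by linarith, hp⟩
    have hEw0 : 0 ≤ E (((p:ℤ):ℝ) * W₁.period + W₁.start j) := hEnn _ hIw0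
    calc E (0 + (p + 1) * W₁.period) ≤ E (((p:ℤ):ℝ) * W₁.period + W₁.start j + (W₁.phase j).τ) := hEanti hIw1 hI1 hw1
      _ ≤ Real.exp (-(ε * c ^ 2 * (2 - ((∑ a, Torus.twistFreq G₀ (fun i => (W₁.phase j).m i * (n : ℤ)) a ^ 2)
          - (∑ i, Torus.twistFreq G₀ K0 i * Torus.twistFreq G₀ (fun i => (W₁.phase j).m i * (n : ℤ)) i) ^ 2 / ∑ a, Torus.twistFreq G₀ K0 a ^ 2)
        * (1 / (∑ a, (Torus.twistFreq G₀ K0 + Torus.twistFreq G₀ (fun i => (W₁.phase j).m i * (n : ℤ))) a ^ 2)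
          + 1 / (∑ a, (Torus.twistFreq G₀ K0 - Torus.twistFreq G₀ (fun i => (W₁.phase j).m i * (n : ℤ))) a ^ 2))) * (W₁.phase j).τ / 27)) * E (((p:ℤ):ℝ) * W₁.period + W₁.start j) := hstep
      _ ≤ Real.exp (-κ₀) * E (((p:ℤ):ℝ) * W₁.period + W₁.start j) :=
          mul_le_mul_of_nonneg_right (Real.exp_le_exp.2 (by linarith)) hEw0
      _ ≤ Real.exp (-κ₀) * E (0 + p * W₁.period) := mul_le_mul_of_nonneg_left (hEanti hI0 hIw0 hw0) (Real.exp_pos _).le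
  -- the profile
  filter_upwards [hEae, ae_restrict_mem measurableSet_Ioo] with t hEt htI
  rw [← hEt, ← hE0]
  have hprof := profile_capped_on hP0 hκ₀pos.le hEanti hEnn hper (Ioo_subset_Icc_self htI)
  have e : -(min κ₀ 1 / W₁.period) * (t - 0) = -(2 * (min κ₀ 1 / (7440 * M)) * ν * t) := by
    rw [hP]; field_simp; ring
  rw [e] at hprof
  exact hprof

/-! ## §3 All classes: near engine ⊕ far (bare) engine, frame-uniform -/

/-- **`ClassDecayWθ G₀` FOR ALL CLASSES of the cubature cell problem at every frame `|G₀ − 1| ≤ θW`**, `ν₀ = 1`, `CK = e`, explicit frame-uniform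
`cK > 0`: the near-class engine `classDecayWθ_chain` (k̃ < 1/2) spliced with the frozen bare far-class engine `classDecayWθ_bare` (k̃ ≥ 1/2, frame
non-degeneracy `c₀ = (1 − 3θW)²`) by `classDecayWθ_split_kt`. [cite: BedrossianCotiZelati2017, Thm 1.1 / §2 (hypocoercivity, ν-uniform rate)] -/
theorem classDecayWθ_cubature_all (M : ℝ) (hM : 0 < M) {lo hi Λ β Kb : ℝ} (hlo : 0 < lo) (hlo1 : lo ≤ 1) (hhi : 1 ≤ hi)
    (hΛ : 1 < Λ) (hβ : 0 ≤ β) (hKb : 1 ≤ Kb) :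
    ∃ θW > (0:ℝ), θW ≤ 1 / 6 ∧ ∃ cK > (0:ℝ), ∀ G₀ : Matrix (Fin 3) (Fin 3) ℝ, (∀ i j, |G₀ i j - (1 : Matrix (Fin 3) (Fin 3) ℝ) i j| ≤ θW) →
      ClassDecayWθ G₀ cubatureWord M hM lo hi Λ β 1 Kb (Real.exp 1) cK admAll := by
  obtain ⟨θW, hθW0, hθW6, cK₁, hcK₁, h₁⟩ := classDecayWθ_chain M hM hlo hlo1 hhi hΛ hβ hKb
  have hΛ0 : 0 < Λ := by linarith
  have hc₀pos : 0 < (1 - 3 * θW) ^ 2 := by nlinarith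
  refine ⟨θW, hθW0, hθW6, min cK₁ (4 * Real.pi ^ 2 * lo * (1 - 3 * θW) ^ 2 * (1 / 2) ^ 2 / Λ), lt_min hcK₁ (by positivity), ?_⟩
  intro G₀ hG
  have hGc : ∀ k' : Fin 3 → ℤ, (1 - 3 * θW) ^ 2 * freqNormSq k' ≤ ∑ a, Torus.twistFreq G₀ k' a ^ 2 :=
    fun k' => le_freqNormSq_twist hθW0.le (by linarith) hG k'
  have h₂ := classDecayWθ_bare hc₀pos hGc cubatureWord M hM (hi := hi) hlo (by linarith) hΛ.le β 1 Kb (κ := 1 / 2) (by norm_num)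
  have h := classDecayWθ_split_kt (1 / 2) (Real.exp_pos 1).le (h₁ G₀ hG) h₂
  have h1e : (1:ℝ) ≤ Real.exp 1 := Real.one_le_exp (by norm_num)
  rw [min_self, max_eq_left h1e] at h
  exact h

end Summit.AnomalousDissipation.AnomalousDissipation.Theorems.SolenoidalFractalHomogenisation.LagrangianStep.W7Cell

end
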